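import Summits.Schanuel.Schanuel.Theorems.ZilberEacGrowthExponent
import Summits.Schanuel.Schanuel.Theorems.ZilberEacRelationGeneral
import Mathlib.Topology.MetricSpace.Pseudo.Defs
import HarnessLib

/-!
# THEOREM I⁽ᵏ⁾: `k` coordinates with independent power growth support no polynomial relation

Zilber's Exponential-Algebraic Closedness, case ladder (host summit Schanuel, cell `pub-schanuel`,
seat 2, gen 15).  The elimination engine of the CANCELLING-FIBRE regime
(`ZilberEacCancellingFibreExistence` / `…Density`): THEOREM I (`ZilberEacGrowthExponent`, two
coordinates `u, v` with `log ‖u_m‖ = κ T_m + O(1)`, `log ‖v_m‖ = μ T_m + O(1)` and `ℚ`-independent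
`κ, μ`) in any number of variables and in the per-polynomial form that the density criterion
`unprojectedDense_of_no_relation` (THEOREM H⁽ᵏ⁾) consumes.

* **`eventually_eval_ne_zero_of_powerGrowth`** — if `z_m ∈ ℂᵏ` has `z_{m,i} ≠ 0` and
  `|log ‖z_{m,i}‖ - γᵢ T_m| ≤ E` with `T_m → ∞`, and the weight `d ↦ Σᵢ dᵢγᵢ` is injective on the
  support of `H ≠ 0`, then `H(z_m) ≠ 0` for all large `m` (the monomial of largest weight dominates:
  `eventually_sum_ne_zero_of_expGrowth`).
* **`exists_mem_injOn_affine`** — weights affine in a parameter `β`, `d ↦ L₁(d) + β L₂(d)` with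
  `(L₁, L₂)` jointly injective on a finite set, are injective for some `β` in any neighbourhood:
  only finitely many `β` are bad.
* **`unprojectedDense_of_powerGrowth_family`** — density form: an irreducible `S` of dimension
  `≤ k + 1` is the Zariski closure of its exponential points as soon as, for every nonzero
  `H ∈ ℂ[X₀, …, X_k]`, SOME sequence of exponential points of `S` has `k + 1` prescribed coordinates
  of power growth with exponents whose weight is injective on the support of `H`.

HONEST FRAMING: elimination lemmas serving explicit families inside the OPEN cell `EC(3,2)`;
NOT Schanuel's conjecture; EAC ⇏ SC.
-/

noncomputable section

open MvPolynomial Filter Topology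
open Literature.NumberTheory.Transcendental Literature.ModelTheory.Zilber

set_option linter.dupNamespace false

namespace Summit.Schanuel.Schanuel.Theorems

/-! ## Part A. THEOREM I⁽ᵏ⁾, sequence form -/

section PowerGrowth

variable {k : ℕ}

/-- **THEOREM I⁽ᵏ⁾ (power growth with injective weights kills every relation).**  `H ≠ 0` in
`ℂ[X₀, …, X_{k-1}]`, real exponents `γ` whose weight `d ↦ Σᵢ dᵢ γᵢ` is injective on the support
of `H`, and a sequence `z_m ∈ ℂᵏ` with `z_{m,i} ≠ 0`, `|log ‖z_{m,i}‖ - γᵢ T_m| ≤ E` for all large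
`m`, where `T_m → ∞`.  Then `H(z_m) ≠ 0` for all large `m`. (new) -/
theorem eventually_eval_ne_zero_of_powerGrowth (H : MvPolynomial (Fin k) ℂ) (hH : H ≠ 0)
    (γ : Fin k → ℝ) (hinj : Set.InjOn (fun d : Fin k →₀ ℕ => ∑ i, (d i : ℝ) * γ i) H.support)
    {z : ℕ → Fin k → ℂ} {T : ℕ → ℝ} (hT : Tendsto T atTop atTop) {E : ℝ}
    (hz : ∀ i, ∀ᶠ m in atTop, z m i ≠ 0 ∧ |Real.log ‖z m i‖ - γ i * T m| ≤ E) :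
    ∀ᶠ m in atTop, eval (z m) H ≠ 0 := by
  classical
  have hsupp : H.support.Nonempty :=
    Finset.nonempty_iff_ne_empty.2 fun h => hH (support_eq_empty.1 h)
  set Es : ℝ := ∑ d ∈ H.support, (|Real.log ‖coeff d H‖| + (∑ i, (d i : ℝ)) * |E|) with hEs
  have hall : ∀ᶠ m in atTop, ∀ i, z m i ≠ 0 ∧ |Real.log ‖z m i‖ - γ i * T m| ≤ E :=
    eventually_all.2 hz
  have key := eventually_sum_ne_zero_of_expGrowth H.support hsupp
    (fun d : Fin k →₀ ℕ => ∑ i, (d i : ℝ) * γ i) hinj hT Es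
    (fun m d => coeff d H * ∏ i, z m i ^ (d i)) ?_
  · filter_upwards [key] with m hm
    rwa [MvPolynomial.eval_eq']
  filter_upwards [hall] with m hm d hd
  have hc : coeff d H ≠ 0 := mem_support_iff.1 hd
  have hzi : ∀ i, z m i ≠ 0 := fun i => (hm i).1
  have hprod0 : (∏ i, z m i ^ (d i)) ≠ 0 :=
    Finset.prod_ne_zero_iff.2 fun i _ => pow_ne_zero _ (hzi i)
  have hpos : 0 < ‖coeff d H * ∏ i, z m i ^ (d i)‖ := norm_pos_iff.2 (mul_ne_zero hc hprod0)
  have hnorm : ‖coeff d H * ∏ i, z m i ^ (d i)‖ = ‖coeff d H‖ * ∏ i, ‖z m i‖ ^ (d i) := by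
    rw [norm_mul, norm_prod]
    simp_rw [norm_pow]
  have hpow0 : ∀ i ∈ (Finset.univ : Finset (Fin k)), ‖z m i‖ ^ (d i) ≠ 0 :=
    fun i _ => pow_ne_zero _ (norm_ne_zero_iff.2 (hzi i))
  have hlog : Real.log ‖coeff d H * ∏ i, z m i ^ (d i)‖ =
      Real.log ‖coeff d H‖ + ∑ i, (d i : ℝ) * Real.log ‖z m i‖ := by
    rw [hnorm, Real.log_mul (norm_ne_zero_iff.2 hc) (Finset.prod_ne_zero_iff.2 hpow0),
      Real.log_prod hpow0]
    refine congrArg _ (Finset.sum_congr rfl fun i _ => ?_)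
    rw [Real.log_pow]
  have hdev : |Real.log ‖coeff d H * ∏ i, z m i ^ (d i)‖ - (∑ i, (d i : ℝ) * γ i) * T m| ≤ Es := by
    rw [hlog]
    have hre : Real.log ‖coeff d H‖ + ∑ i, (d i : ℝ) * Real.log ‖z m i‖ -
        (∑ i, (d i : ℝ) * γ i) * T m =
        Real.log ‖coeff d H‖ + ∑ i, (d i : ℝ) * (Real.log ‖z m i‖ - γ i * T m) := by
      rw [Finset.sum_mul, add_sub_assoc, ← Finset.sum_sub_distrib]
      refine congrArg _ (Finset.sum_congr rfl fun i _ => ?_)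
      ring
    rw [hre]
    calc |Real.log ‖coeff d H‖ + ∑ i, (d i : ℝ) * (Real.log ‖z m i‖ - γ i * T m)|
        ≤ |Real.log ‖coeff d H‖| + |∑ i, (d i : ℝ) * (Real.log ‖z m i‖ - γ i * T m)| :=
          abs_add_le _ _
      _ ≤ |Real.log ‖coeff d H‖| + ∑ i, (d i : ℝ) * |E| := by
          gcongr
          refine (Finset.abs_sum_le_sum_abs _ _).trans (Finset.sum_le_sum fun i _ => ?_)
          rw [abs_mul, Nat.abs_cast]
          exact mul_le_mul_of_nonneg_left (((hm i).2).trans (le_abs_self E)) (Nat.cast_nonneg _)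
      _ = |Real.log ‖coeff d H‖| + (∑ i, (d i : ℝ)) * |E| := by rw [Finset.sum_mul]
      _ ≤ Es := by
          rw [hEs]
          exact Finset.single_le_sum (f := fun d : Fin k →₀ ℕ =>
            |Real.log ‖coeff d H‖| + (∑ i, (d i : ℝ)) * |E|)
            (fun d _ => by positivity) hd
  obtain ⟨hlo, hhi⟩ := abs_le.1 hdev
  constructor
  · calc Real.exp ((∑ i, (d i : ℝ) * γ i) * T m - Es)
        ≤ Real.exp (Real.log ‖coeff d H * ∏ i, z m i ^ (d i)‖) :=
          Real.exp_le_exp.2 (by linarith)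
      _ = ‖coeff d H * ∏ i, z m i ^ (d i)‖ := Real.exp_log hpos
  · calc ‖coeff d H * ∏ i, z m i ^ (d i)‖
        = Real.exp (Real.log ‖coeff d H * ∏ i, z m i ^ (d i)‖) := (Real.exp_log hpos).symm
      _ ≤ Real.exp ((∑ i, (d i : ℝ) * γ i) * T m + Es) := Real.exp_le_exp.2 (by linarith)

/-- **Generic parameters for affine weights.**  If `(L₁, L₂)` is jointly injective on the finite
set `S`, then for every neighbourhood `U` of a real number some `β ∈ U` makes `d ↦ L₁(d) + β L₂(d)`
injective on `S` (each pair `d ≠ d'` excludes at most one `β`). [folklore] -/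
theorem exists_mem_injOn_affine {ι : Type*} (S : Finset ι) (L₁ L₂ : ι → ℝ)
    (hL : ∀ d ∈ S, ∀ d' ∈ S, L₁ d = L₁ d' → L₂ d = L₂ d' → d = d')
    {U : Set ℝ} {β₀ : ℝ} (hU : U ∈ 𝓝 β₀) :
    ∃ β ∈ U, Set.InjOn (fun d => L₁ d + β * L₂ d) S := by
  classical
  obtain ⟨ε, hε, hball⟩ := Metric.mem_nhds_iff.1 hU
  set B : Finset ℝ := ((S ×ˢ S).filter fun p => L₂ p.1 ≠ L₂ p.2).image
    fun p => -(L₁ p.1 - L₁ p.2) / (L₂ p.1 - L₂ p.2) with hB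
  have hinf : (Set.Ioo (β₀ - ε) (β₀ + ε)).Infinite := Set.Ioo_infinite (by linarith)
  obtain ⟨β, hβI, hβB⟩ := hinf.exists_notMem_finset B
  refine ⟨β, hball (by rw [Real.ball_eq_Ioo]; exact hβI), fun d hd d' hd' hdd => ?_⟩
  by_cases h2 : L₂ d = L₂ d'
  · have h1 : L₁ d = L₁ d' := by
      have := hdd
      simp only at this
      rw [h2] at this
      linarith
    exact hL d hd d' hd' h1 h2
  · exfalso
    apply hβB
    rw [hB, Finset.mem_image]
    refine ⟨(d, d'), Finset.mem_filter.2 ⟨Finset.mk_mem_product hd hd', h2⟩, ?_⟩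
    have hne : L₂ d - L₂ d' ≠ 0 := sub_ne_zero.2 h2
    simp only at hdd
    field_simp
    linarith

end PowerGrowth

/-! ## Part B. Density form -/

section Density

variable {n : ℕ}

/-- **THEOREM I⁽ᵏ⁾, density form (per-polynomial families).**  `S` irreducible closed with
`dim S ≤ k + 1` and coordinates `c₀, …, c_k`.  Suppose that for every nonzero
`H ∈ ℂ[X₀, …, X_k]` there are exponents `γ` with `d ↦ Σ dᵢγᵢ` injective on the support of `H` and
a sequence of points, eventually exponential points of `S`, whose `c`-coordinates are nonzero with
`|log ‖p_m(cᵢ)‖ - γᵢ T_m| ≤ E`, `T_m → ∞`.  Then `I(S ∩ Γ_exp) = I(S)`. (new) -/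
theorem unprojectedDense_of_powerGrowth_family {S : Set (Fin n ⊕ Fin n → ℂ)}
    (hS : IsIrreducibleClosed ℂ S) {k : ℕ} (hdim : zariskiDim ℂ S ≤ ((k + 1 : ℕ) : WithBot ℕ∞))
    (c : Fin (k + 1) → Fin n ⊕ Fin n)
    (hfam : ∀ H : MvPolynomial (Fin (k + 1)) ℂ, H ≠ 0 →
      ∃ γ : Fin (k + 1) → ℝ, Set.InjOn (fun d : Fin (k + 1) →₀ ℕ => ∑ i, (d i : ℝ) * γ i) H.support ∧
        ∃ (p : ℕ → Fin n ⊕ Fin n → ℂ) (T : ℕ → ℝ) (E : ℝ), Tendsto T atTop atTop ∧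
          (∀ᶠ m in atTop, p m ∈ S ∧ p m ∈ expGraph ℂ n) ∧
          ∀ i, ∀ᶠ m in atTop, p m (c i) ≠ 0 ∧ |Real.log ‖p m (c i)‖ - γ i * T m| ≤ E) :
    UnprojectedDense S := by
  refine unprojectedDense_of_no_relation hS hdim c fun H hH => ?_
  obtain ⟨γ, hinj, p, T, E, hT, hmem, hz⟩ := hfam H hH
  have hev := eventually_eval_ne_zero_of_powerGrowth H hH γ hinj (z := fun m i => p m (c i)) hT hz
  obtain ⟨m, hmS, hne⟩ := (hmem.and hev).exists
  exact ⟨p m, hmS, hne⟩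

end Density

end Summit.Schanuel.Schanuel.Theorems

end
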